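import Literature.AlgebraicGeometry.AbelianSchemes.AbelianSchemeSmallExtensionPicardTorsor
import HarnessLib

/-!
# Rank-one liftings along a small extension of an abelian scheme form an `H¹(𝓘)`-torsor — ★ (Sb) with the idle `ℚ`-algebra
# hypothesis REMOVED (letter (Sb′) of the (s2-D) road (A), any characteristic)

Layer `Literature/AlgebraicGeometry/AbelianSchemes`, namespace `Literature.AlgebraicGeometry.AbelianSchemes.AbelianSchemeOver`.
THEOREMS ONLY (no definition, no named fact, no instance, no notation, no `sorry`; net Literature debt 0).

[Hartshorne2010] §6 Thm. 6.4 (b)–(d) and Rem. 6.4.1 (pp. 50–51): for a flat deformation `X′ → Spec C′` of `X → Spec C` along a small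
extension `C′ ↠ C`, the rank-one liftings of a line bundle form a torsor under `H¹(X, 𝓘𝒪_{X′})`; [GortzWedhorn2023] Cor. 24.63 (p. 404).
★ `AbelianSchemeSmallExtensionPicardTorsor.existsUnique_detClassH_eq_add_truncExp_smallExtension` (the letter `stub_F3McN3Sb` of the F-3 (Mc) N3′
sub-skeleton) states this for `A′ = A ×_R S′` over a Noetherian affine `ℚ`-ALGEBRA `R`; its proof (★ `exists_detClassH_eq_add_map_truncExp_of_pullback_iso`
— transitive —, ★ `rankOneLiftings_free_of_flat` — free: `X → Spec C` flat and `H⁰(𝒪_{A′_κ}) = κ` by Stein, ★ `specStructureMap_quotientFibreSnd_bijective`)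
NEVER USES the `ℚ`-structure: the binder `[Algebra ℚ R]` is idle.  THIS FILE re-runs the ★ proof verbatim without it —
**`existsUnique_detClassH_eq_add_truncExp_smallExtension_anyBase`** — the (Sb′) twin that the (s2-D) road (A) re-thread reads at characteristic `p`
(B-p04 (g39) census 2026-09-01T22:43:58Z «(Sb′) … minus ℚ (S–M: body is first-order `truncExp`, char-free)» — confirmed: 0 proof bytes changed).

Cell `hodgecm-mathlib` (D-0151), P6 «MOD programme», PAY-DOWN CAPITAL of the printed row P-2′ «DUAL-S» (LEAD F0P6-plan «M-29» (2); B-p04 (g40)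
offer (O3); road (A) Literature twins (K′) ★ p847009 · (P3a∕b) ★ p847033∕p847045 · (P2′) ★ p847051 · (Mb′) ★ p847247 · (Ma′) filed · (Sb′) this ·
(Se′) open — it consumes `hH1` = H1-DIM, B-p02՚s D2).  Count-neutral; HC_CM is proved only modulo the printed citations (2 remaining named inputs
hLiu418 24832, h413 24833) until rung 0 closes; nothing here is about HC.

## References
* [Hartshorne2010] R. Hartshorne, *Deformation Theory* (GTM 257, 2010), §6 Thm. 6.4 (b)–(d), Remark 6.4.1 (pp. 50–51).
* [GortzWedhorn2023] U. Görtz, T. Wedhorn, *Algebraic Geometry II* (2023), Cor. 24.63 (p. 404).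
* [MumfordAV1970] D. Mumford, *Abelian Varieties* (1970), §13 (pp. 123–131).
* Tree: ★ `AbelianSchemeSmallExtensionPicardTorsor` (`isPullback_whiskerLeft_left_snd`, `specStructureMap_quotientFibreSnd_bijective`, the (Sb) head),
  ★ `Deformation` lineage (`exists_detClassH_eq_add_map_truncExp_of_pullback_iso`, `rankOneLiftings_free_of_flat`, `truncExp`, `idealSheafAb`, `detClassH`).
-/

noncomputable section

universe u

open CategoryTheory CategoryTheory.Limits AlgebraicGeometry MonoidalCategory IsLocalRing

namespace Literature.AlgebraicGeometry.AbelianSchemes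

open Literature.AlgebraicGeometry.Motives Literature.AlgebraicGeometry.Modules Literature.AlgebraicGeometry.Deformation

namespace AbelianSchemeOver

set_option maxHeartbeats 400000 in
/-- **S-b — RANK-ONE LIFTINGS ALONG `A′_C ⊂ A′_{C′}` FORM A TORSOR UNDER `H¹(𝓘)`** (Hartshorne, *Deformation Theory*, Thm. 6.4 (b)(c)(d)
for the flat deformation `A′ ×_{S′} Spec C′ → Spec C′` of the abelian scheme `A′ = A.baseChange p` along a principal small extension `C′ ↠ C`
of Artinian local rings over `S′`): if a rank-one `E` on `X = A′_C` lifts to `X′ = A′_{C′}` at all, then for any two rank-one liftings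
`L′`, `L″` there is a UNIQUE `t ∈ H¹(X′, 𝓘)` with `[L″] = [L′] + H¹(truncExp)(t)` in `H¹(X′, 𝒪^*)` — transitive by ★
`Modules.exists_detClassH_eq_add_map_truncExp_of_pullback_iso` (6.4 (b)); free by ★ `Modules.rankOneLiftings_free_of_flat` (6.4 (d): `X → Spec C`
is flat and `H⁰(𝒪_{A′_κ}) = κ` by Stein, so global units lift).  The letter `stub_F3McN3Sb` of the (Mc) N3′ sub-skeleton with its idle binder `[Algebra ℚ R]` REMOVED (★ (Sb) proof verbatim; any characteristic).
[cite: Hartshorne2010, §6 Thm. 6.4 (b)–(d) and Rem. 6.4.1 (pp. 50–51)] [cite: GortzWedhorn2023, Cor. 24.63 (p. 404)] -/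
theorem existsUnique_detClassH_eq_add_truncExp_smallExtension_anyBase :
    ∀ (R : Type) [CommRing R] [IsNoetherianRing R] (A : AbelianSchemeOver (Spec (.of R)))
    {S' : Scheme.{0}} [IsAffine S'] (p : S' ⟶ Spec (.of R)) [IsFinite p] [Etale p] [Surjective p]
    (C' C : Type) [CommRing C'] [IsLocalRing C'] [IsArtinianRing C'] [CommRing C] [IsLocalRing C] [IsArtinianRing C]
    (q : C' →+* C) (_hq : Function.Surjective q) (t₀ : C') (_hker : RingHom.ker q = Ideal.span {t₀})
    (_htm : ∀ m ∈ IsLocalRing.maximalIdeal C', t₀ * m = 0) (_ht₀m : t₀ ∈ IsLocalRing.maximalIdeal C')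
    (c' : Spec (.of C') ⟶ S')
    (ι₀ : Over.mk (Spec.map (CommRingCat.ofHom q) ≫ c') ⟶ Over.mk c') (_hι : ι₀.left = Spec.map (CommRingCat.ofHom q))
    [IsFirstOrderThickening ((A.baseChange p).X ◁ ι₀).left]
    (E : ((A.baseChange p).X ⊗ Over.mk (Spec.map (CommRingCat.ofHom q) ≫ c')).left.Modules), HasRank E 1 →
    (∃ (L' : ((A.baseChange p).X ⊗ Over.mk c').left.Modules) (_ : HasRank L' 1),
        Nonempty ((Scheme.Modules.pullback ((A.baseChange p).X ◁ ι₀).left).obj L' ≅ E)) →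
    ∀ (L' L'' : ((A.baseChange p).X ⊗ Over.mk c').left.Modules) (hL' : HasRank L' 1) (hL'' : HasRank L'' 1),
      Nonempty ((Scheme.Modules.pullback ((A.baseChange p).X ◁ ι₀).left).obj L' ≅ E) →
      Nonempty ((Scheme.Modules.pullback ((A.baseChange p).X ◁ ι₀).left).obj L'' ≅ E) →
      ∃! t : (idealSheafAb ((A.baseChange p).X ◁ ι₀).left).H 1,
        detClassH (HasRank.isFiniteLocallyFree' hL'') =
          detClassH (HasRank.isFiniteLocallyFree' hL') + Sheaf.H.map (truncExp ((A.baseChange p).X ◁ ι₀).left) 1 t := by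
  intro R _ _ A S' _ p _ _ _ C' C _ _ _ _ _ _ q hq t₀ hker htm ht₀m c' ι₀ hι hfo E hE hex L' L'' hL' hL'' hL'E hL''E
  obtain ⟨e₁⟩ := hL'E
  obtain ⟨e₂⟩ := hL''E
  -- TRANSITIVE (Thm. 6.4 (b)): some `t` (the thickening instance is passed explicitly)
  obtain ⟨t, ht⟩ := @exists_detClassH_eq_add_map_truncExp_of_pullback_iso _ _ ((A.baseChange p).X ◁ ι₀).left hfo _ _
    hL' hL'' (e₁ ≪≫ e₂.symm)
  refine ⟨t, ht, fun t' ht' => ?_⟩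
  -- FREE (Thm. 6.4 (d)): the data of ★ `rankOneLiftings_free_of_flat` for `X = A′_C → Spec C`, `X′ = A′_{C′} → Spec C′`
  haveI : IsLocallyNoetherian S' := LocallyOfFiniteType.isLocallyNoetherian p
  haveI : Smooth (A.baseChange p).X.hom := (A.baseChange p).isSmooth
  haveI : Flat (A.baseChange p).X.hom := inferInstance
  have hflat : Flat (Limits.pullback.snd (A.baseChange p).X.hom (Spec.map (CommRingCat.ofHom q) ≫ c')) :=
    MorphismProperty.pullback_snd (P := @Flat) _ _ inferInstance
  have Hi : IsPullback ((A.baseChange p).X ◁ ι₀).left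
      (Limits.pullback.snd (A.baseChange p).X.hom (Spec.map (CommRingCat.ofHom q) ≫ c'))
      (Limits.pullback.snd (A.baseChange p).X.hom c') (Spec.map (CommRingCat.ofHom q)) := by
    have h := isPullback_whiskerLeft_left_snd (A.baseChange p).X ι₀
    rw [hι] at h
    exact h
  have hX₀ := (A.baseChange p).specStructureMap_quotientFibreSnd_bijective (Spec.map (CommRingCat.ofHom q) ≫ c')
    (maximalIdeal C)
  have hfree := @rankOneLiftings_free_of_flat _ _ C' C _ _ _ (Limits.pullback.snd (A.baseChange p).X.hom c') q hq t₀ hker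
    ((A.baseChange p).X ◁ ι₀).left (Limits.pullback.snd (A.baseChange p).X.hom (Spec.map (CommRingCat.ofHom q) ≫ c')) ht₀m Hi
    hfo _ _ hflat E hX₀ hex L' L' hL' hL' (t' - t) ⟨e₁⟩
  -- `[L′] = [L′] + H¹(truncExp)(t′ − t)` from the two descriptions of `[L″]`
  have hdiff : detClassH (HasRank.isFiniteLocallyFree' hL') =
      detClassH (HasRank.isFiniteLocallyFree' hL') + Sheaf.H.map (truncExp ((A.baseChange p).X ◁ ι₀).left) 1 (t' - t) := by
    rw [map_sub, ← add_sub_assoc, ← ht', ht, add_sub_cancel_right]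
  exact sub_eq_zero.mp (hfree hdiff ⟨Iso.refl _⟩)

end AbelianSchemeOver

end Literature.AlgebraicGeometry.AbelianSchemes

end
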